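import Literature.ModelTheory.ExponentialFields.KhovanskiiComponents
import HarnessLib

/-!
# Wilkie 1989, §5: Khovanskii's finiteness theorem — proof of the Proposition

Topic `Literature/ModelTheory/ExponentialFields`. **Discharge** of the named fact
`Literature.ModelTheory.ExponentialFields.Wilkie1989_khovanskiiProposition`
(`Wilkie1989Khovanskii.lean`; A. J. Wilkie, *On the theory of the real exponential field*,
Illinois J. Math. 33 (1989), §5, Proposition, p. 402, "result of Khovanskii [3]"):

> for terms `f₁(ȳ, x̄), …, fₚ(ȳ, x̄)` of `L` there is `N` such that for every `β̄ ∈ ℝᵐ` the set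
> `Vⁿˢ(f₁(β̄, ·), …, fₚ(β̄, ·)) ⊆ ℝⁿ` has at most `N` connected components.

**Proof** (`Wilkie1989_khovanskiiProposition_holds`). By the equation `x_{n+1} · S - 1 = 0`,
`S = Σ_I (det ∂f/∂x̄_I)²` the sum of the squares of the `p × p` minors of the Jacobian (the device
of Wilkie's p. 396), the non-singular zero set `Vⁿˢ(f)(β)` corresponds, by `x ↦ (x, 1/S(x))` and
`(x, t) ↦ x`, to the full real zero set of the lifted system `liftSys f S`, all of whose zeros
are regular; connected components correspond (`image_init_connectedComponentIn`), and the lifted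
zero set has uniformly boundedly many components by Khovanskii's theorem in component form
(`Khovanskii.exists_forall_encard_components_le`, `KhovanskiiComponents.lean`, resting on the
zero-counting theorem `KhovanskiiZeroBound.lean`, the Rolle–Khovanskii curve theory of
`Literature/Analysis/ODE/RolleKhovanskii.lean`, the proved Tarski–Seidenberg theorem and Sard's
theorem in equal dimensions). No named facts are used.

## References

* A. J. Wilkie, *On the theory of the real exponential field*, Illinois J. Math. 33 (1989), §5,
  Proposition (p. 402); proof of Lemma 3, p. 396 (the equation `x_{n+1} · f - 1 = 0`). [Wilkie1989]
* A. G. Khovanskii, *Fewnomials and Pfaff manifolds*, Proc. ICM Warsaw 1983. [Khovanskii1984]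
* A. G. Khovanskii, *Fewnomials*, Transl. Math. Monogr. 88, AMS (1991), Ch. III. [Khovanskii1991]
-/

noncomputable section

open FirstOrder FirstOrder.Language FirstOrder.Language.Structure
open Set

namespace Literature.ModelTheory.ExponentialFields

namespace Khovanskii

open ExpTerm RealExpModel

variable {m n p : ℕ} (f : Fin p → Language.orderedExpRing.Term (Fin m ⊕ Fin n)) (β : Fin m → ℝ)

/-! ### The sum of the squares of the `p × p` minors -/

/-- The sum, over all column selections `I`, of the squares of the `p × p` minors of the
Jacobian of terms of `f` (nonzero exactly at the points where the gradient rows are independent;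
Wilkie 1989, p. 396, takes one nonzero minor `f`). [cite: Wilkie1989, proof of Lemma 3, p. 396] -/
def minorSqAll : Language.orderedExpRing.Term (Fin m ⊕ Fin n) :=
  ExpTerm.sum fun l : Fin (Fintype.card (Fin p → Fin n)) =>
    minorTerm f ((Fintype.equivFin (Fin p → Fin n)).symm l) *
      minorTerm f ((Fintype.equivFin (Fin p → Fin n)).symm l)

/-- `minorSqAll` realizes to the sum of the squares of all `p × p` minors. [folklore] -/
theorem realize_minorSqAll (x : Fin n → ℝ) :
    (minorSqAll f).realize (Sum.elim β x) =
      ∑ I : Fin p → Fin n, ((Matrix.of fun r => grad (f r) β x).submatrix _root_.id I).det ^ 2 := by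
  rw [minorSqAll, ExpTerm.realize_sum]
  rw [← (Fintype.equivFin (Fin p → Fin n)).symm.sum_comp]
  refine Finset.sum_congr rfl fun l _ => ?_
  rw [ExpTerm.realize_mul, realize_minorTerm, pow_two]

/-- `minorSqAll ≠ 0` exactly where the gradient rows of `f` are linearly independent. [folklore] -/
theorem realize_minorSqAll_ne_zero_iff (x : Fin n → ℝ) :
    (minorSqAll f).realize (Sum.elim β x) ≠ 0 ↔ LinearIndependent ℝ (fun r => grad (f r) β x) := by
  rw [realize_minorSqAll, linearIndependent_rows_iff_exists_det_submatrix_ne_zero]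
  constructor
  · intro h
    by_contra hall
    push Not at hall
    apply h
    exact Finset.sum_eq_zero fun I _ => by
      rw [pow_eq_zero_iff two_ne_zero]
      exact hall I
  · rintro ⟨I, hI⟩ hsum
    have h0 := (Finset.sum_eq_zero_iff_of_nonneg fun I _ => sq_nonneg _).1 hsum I (Finset.mem_univ I)
    exact hI (pow_eq_zero_iff two_ne_zero |>.1 h0)

/-! ### The lifted system and its zero set -/

/-- **The lifted system** `f₁, …, fₚ, x_{n+1} · S - 1` (`S = minorSqAll f`). [cite: Wilkie1989, proof of Lemma 3, p. 396] -/
def liftNs : Fin (p + 1) → Language.orderedExpRing.Term (Fin m ⊕ Fin (n + 1)) :=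
  liftSys f (minorSqAll f)

/-- The real zeros of the lifted system: `(x, t)` with `x ∈ Vⁿˢ(f)(β)` and `t = 1 / S(x)`.
[folklore] -/
theorem mem_zeroSetR_liftNs_iff (w : Fin (n + 1) → ℝ) :
    w ∈ zeroSetR (liftNs f) β ↔
      Fin.init w ∈ realNonsingularZeroSet f β ∧
        w (Fin.last n) * (minorSqAll f).realize (Sum.elim β (Fin.init w)) = 1 := by
  rw [mem_zeroSetR, mem_realNonsingularZeroSet, ← realize_minorSqAll_ne_zero_iff]
  conv_lhs => rw [← Fin.snoc_init_self w]
  constructor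
  · intro h
    have hlast := h (Fin.last p)
    rw [liftNs, realize_liftSys_last'] at hlast
    have hcs : ∀ r, (f r).realize (Sum.elim β (Fin.init w)) = 0 := fun r => by
      have := h (Fin.castSucc r)
      rwa [liftNs, realize_liftSys_castSucc'] at this
    have h1 : w (Fin.last n) * (minorSqAll f).realize (Sum.elim β (Fin.init w)) = 1 := by
      linarith
    refine ⟨⟨hcs, fun h0 => ?_⟩, h1⟩
    rw [h0, mul_zero] at h1
    exact zero_ne_one h1
  · rintro ⟨⟨hcs, _⟩, h1⟩ r
    refine Fin.lastCases ?_ (fun r => ?_) r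
    · rw [liftNs, realize_liftSys_last']
      linarith
    · rw [liftNs, realize_liftSys_castSucc']
      exact hcs r

/-- **All real zeros of the lifted system are regular.** [cite: Wilkie1989, proof of Lemma 3, pp. 396–397] -/
theorem linearIndependent_grad_liftNs {w : Fin (n + 1) → ℝ} (hw : w ∈ zeroSetR (liftNs f) β) :
    LinearIndependent ℝ (fun i => grad (liftNs f i) β w) := by
  obtain ⟨hns, h1⟩ := (mem_zeroSetR_liftNs_iff f β w).1 hw
  have hS : (minorSqAll f).realize (Sum.elim β (Fin.init w)) ≠ 0 := fun h0 => by
    rw [h0, mul_zero] at h1; exact zero_ne_one h1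
  have h := linearIndependent_grad_liftSys_real (y := w (Fin.last n)) hns.2 hS
  rw [Fin.snoc_init_self] at h
  exact h

/-- The map `x ↦ (x, 1 / S(x))` into the lifted zero set. [folklore] -/
def liftV (x : Fin n → ℝ) : Fin (n + 1) → ℝ :=
  Fin.snoc x ((minorSqAll f).realize (Sum.elim β x))⁻¹

/-- `liftV` maps `Vⁿˢ(f)(β)` into the lifted zero set. [folklore] -/
theorem liftV_mem {x : Fin n → ℝ} (hx : x ∈ realNonsingularZeroSet f β) :
    liftV f β x ∈ zeroSetR (liftNs f) β := by
  rw [mem_zeroSetR_liftNs_iff, liftV, Fin.init_snoc, Fin.snoc_last]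
  refine ⟨hx, inv_mul_cancel₀ ?_⟩
  rw [realize_minorSqAll_ne_zero_iff]
  exact hx.2

/-- `Fin.init` maps the lifted zero set onto `Vⁿˢ(f)(β)`. [folklore] -/
theorem init_mem {w : Fin (n + 1) → ℝ} (hw : w ∈ zeroSetR (liftNs f) β) :
    Fin.init w ∈ realNonsingularZeroSet f β :=
  ((mem_zeroSetR_liftNs_iff f β w).1 hw).1

omit m p in
/-- `Fin.init` is continuous. [folklore] -/
theorem continuous_init : Continuous (Fin.init : (Fin (n + 1) → ℝ) → Fin n → ℝ) :=
  continuous_pi fun j => continuous_apply (Fin.castSucc j)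

/-- `liftV` is continuous on `Vⁿˢ(f)(β)`. [folklore] -/
theorem continuousOn_liftV : ContinuousOn (liftV f β) (realNonsingularZeroSet f β) := by
  refine continuousOn_pi.2 fun j => ?_
  refine Fin.lastCases ?_ (fun j => ?_) j
  · simp only [liftV, Fin.snoc_last]
    refine ContinuousOn.inv₀ (continuous_realize (minorSqAll f) β).continuousOn fun x hx => ?_
    rw [realize_minorSqAll_ne_zero_iff]
    exact hx.2
  · simp only [liftV, Fin.snoc_castSucc]
    exact (continuous_apply j).continuousOn

/-- **Components correspond**: for `x ∈ Vⁿˢ(f)(β)`, the component of `x` in `Vⁿˢ` is the image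
under `(x, t) ↦ x` of the component of `(x, 1/S(x))` in the lifted zero set. [folklore] -/
theorem image_init_connectedComponentIn {x : Fin n → ℝ} (hx : x ∈ realNonsingularZeroSet f β) :
    Fin.init '' connectedComponentIn (zeroSetR (liftNs f) β) (liftV f β x) =
      connectedComponentIn (realNonsingularZeroSet f β) x := by
  have hinit : Fin.init (liftV f β x) = x := by rw [liftV, Fin.init_snoc]
  apply Subset.antisymm
  · refine IsPreconnected.subset_connectedComponentIn
      (isPreconnected_connectedComponentIn.image _ continuous_init.continuousOn) ?_ ?_
    · exact ⟨liftV f β x, mem_connectedComponentIn (liftV_mem f β hx), hinit⟩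
    · rintro _ ⟨w, hw, rfl⟩
      exact init_mem f β (connectedComponentIn_subset _ _ hw)
  · intro y hy
    have hyV : y ∈ realNonsingularZeroSet f β := connectedComponentIn_subset _ _ hy
    refine ⟨liftV f β y, ?_, by rw [liftV, Fin.init_snoc]⟩
    have hsub : liftV f β '' connectedComponentIn (realNonsingularZeroSet f β) x ⊆
        connectedComponentIn (zeroSetR (liftNs f) β) (liftV f β x) := by
      refine IsPreconnected.subset_connectedComponentIn
        (isPreconnected_connectedComponentIn.image _
          ((continuousOn_liftV f β).mono (connectedComponentIn_subset _ _))) ?_ ?_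
      · exact ⟨x, mem_connectedComponentIn hx, rfl⟩
      · rintro _ ⟨z, hz, rfl⟩
        exact liftV_mem f β (connectedComponentIn_subset _ _ hz)
    exact hsub ⟨y, hy, rfl⟩

/-- Hence `Vⁿˢ(f)(β)` has at most as many connected components as the lifted zero set.
[folklore] -/
theorem encard_components_le_lift :
    (Set.range fun x : realNonsingularZeroSet f β =>
        connectedComponentIn (realNonsingularZeroSet f β) (x : Fin n → ℝ)).encard ≤
      (Set.range fun w : zeroSetR (liftNs f) β =>
        connectedComponentIn (zeroSetR (liftNs f) β) (w : Fin (n + 1) → ℝ)).encard := by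
  have hsub : (Set.range fun x : realNonsingularZeroSet f β =>
      connectedComponentIn (realNonsingularZeroSet f β) (x : Fin n → ℝ)) ⊆
        (fun B => Fin.init '' B) '' (Set.range fun w : zeroSetR (liftNs f) β =>
          connectedComponentIn (zeroSetR (liftNs f) β) (w : Fin (n + 1) → ℝ)) := by
    rintro _ ⟨⟨x, hx⟩, rfl⟩
    exact ⟨_, ⟨⟨liftV f β x, liftV_mem f β hx⟩, rfl⟩, image_init_connectedComponentIn f β hx⟩
  exact (encard_le_encard hsub).trans (encard_image_le _ _)

end Khovanskii

/-! ### The Proposition -/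

/-- **Wilkie 1989, §5, Proposition (Khovanskii's finiteness theorem) — proved.** For terms
`f₁(ȳ, x̄), …, fₚ(ȳ, x̄)` of `L` there is `N ∈ ℕ` such that for every `β̄ ∈ ℝᵐ` the subset
`Vⁿˢ(f₁(β̄, ·), …, fₚ(β̄, ·))` of `ℝⁿ` has at most `N` connected components. Discharge of the
named fact `Wilkie1989_khovanskiiProposition`. [cite: Wilkie1989, §5, Proposition, p. 402] [cite: Khovanskii1984, Theorem on Pfaff manifolds] -/
theorem Wilkie1989_khovanskiiProposition_holds : Wilkie1989_khovanskiiProposition := by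
  intro m n p f _
  obtain ⟨N, hN⟩ := Khovanskii.exists_forall_encard_components_le (Khovanskii.liftNs f)
  refine ⟨N, fun β => ?_⟩
  exact (Khovanskii.encard_components_le_lift f β).trans
    (hN β fun w hw => Khovanskii.linearIndependent_grad_liftNs f β hw)

end Literature.ModelTheory.ExponentialFields
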